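import Literature.MathematicalPhysics.QuantumFieldTheory.Balaban1983to89.B1Eq324BenfattoKernelEq324
import Literature.MathematicalPhysics.QuantumFieldTheory.Balaban1983to89.B1Eq324BenfattoClassRescale
import HarnessLib

/-!
# `Balaban1983to89.B1Eq324BenfattoKernelEq324AnyGamma` — [Balaban1982Higgs1] (3.24) p. 616 FOR THE GAUSSIAN FIELD OF EVERY CLASS MEMBER,
# ANY COERCIVITY CONSTANT `γ_A > 0` ([BenfattoEtAl1978] Lemma p. 152 in OUR class form of [Balaban1985BackgroundPropagators] Sect. E): seat n08-d's
# `…KernelEq324.eq324_kernel_noPad` (`2 ≤ γ_A`) composed with the field rescaling of `…ClassRescale` — PROVED, no definition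

statement-level companion of a published source with citation tags; every declaration here is a theorem; nothing here is
a claim about the Yang–Mills mass gap

WHY THIS MODULE (cell `pub-ymgap`, seat `dag-n08-b` gen 14, INTENT-2; node N08 [Balaban1985UV3]; the [BenfattoEtAl1978] source chain behind the
(α)-row `h324c`).  The class road ends in seat n08-d's `…KernelEq324.eq324_kernel_noPad`: (3.24) in `η`-currency for `μ_K = 𝒩(0,K)` of every class
member `(Λ, A, K)` — under print's normalisation «E z_Δ² = ½» in the form `2 ≤ γ_A`.  A member presented by an instantiation has SOME `γ_A > 0`
(N06's `γ₀`).  This file removes the normalisation (§1): run `eq324_kernel_noPad` on the scaled member `(Λ, λ²A, λ⁻²K)`, `λ = max 1 √(2/γ_A)`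
(`…ClassRescale.exists_normalising_scale`: `λ ≥ 1`, `λ²γ_A ≥ 2`; rows `λ²J_c, λ²M, λ²M₂` by `…ClassRescale` §3), at threshold constant `b₀/λ`
and coefficient constant `(max 1 λ)^D·c` on the scaled coefficients `a_λ`, and read its conclusion back on `(Λ, A, K)` at `b₀` through
`…ClassRescale.integral_cutoffBoltzmann_scaled_kernel_eq` / `cumulantSum_scaled_kernel_eq` / `pFun_div`.  §2 then states the road's output with the
member described as [Balaban1985BackgroundPropagators] Sect. E describes `C*Δ_kC`: symmetric, uniformly coercive, uniformly exponentially decaying —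
the three rows `J_c, M, M₂` and the rate `θ` are derived inside (seat n08-d's `…ClassEntryRows` §4), so nothing but `(γ_A, K_A, κ_A)` is displayed.

WHAT IS PROVED (standard axioms; no `sorry`; no definition).
* §1 ★★★ `eq324_kernel_noPad_anyGamma` — `eq324_kernel_noPad` VERBATIM with `(hγA0 : 0 < γA)` in place of `(hγA2 : 2 ≤ γA)` (and `η₀, C` now also
  depending on `γ_A` through `λ`); `eq324_kernel_noPad_anyGamma_seven` (`t = 6`, `σ = ½`, `κ = 13/4`).
* §2 ★★★ `eq324_kernel_of_expDecay` — THE OUTPUT IN SECT. E's CURRENCY: the member rows replaced by `A` symmetric, `γ_A`-coercive (`γ_A > 0`) and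
  `|A e e′| ≤ K_A e^{−κ_A|e−e′|₂}`; the rate `θ` and the rows `J_c, M, M₂` are chosen∕derived inside from `(γ_A, K_A, κ_A, d)` by seat n08-d's
  `…ClassEntryRows.classRow_{Jc,M,M₂}_le_of_abs_le_exp`; `eq324_kernel_of_expDecay_seven`.
HONEST SCOPE.  Composition by name of two landed theorems of this cell; (3.24) for the Gaussian field of OUR class (finite `Λ ⊂ ℤ^d`, Euclidean rows);
the IDENTIFICATION at [Balaban1985UV3]'s objects (member and rows from N06, cut-offs and `𝒱` through seat n08-w4's (α)-socket, CHECK C on wrapped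
regions) is NOT commissioned and NOT claimed; count-neutral for N08; nothing about d = 4, the continuum, OS axioms, a mass gap or the Clay problem.
-/

noncomputable section

open MeasureTheory Finset Matrix

namespace Literature.MathematicalPhysics.QuantumFieldTheory.Balaban1983to89.B1Eq324BenfattoKernelEq324AnyGamma

open Literature.MathematicalPhysics.QuantumFieldTheory
open Literature.MathematicalPhysics.QuantumFieldTheory.Balaban1983to89.B1Eq324BenfattoLemma
open Literature.MathematicalPhysics.QuantumFieldTheory.Balaban1983to89.B1Eq324BenfattoKernelEq324 (eq324_kernel_noPad)
open Literature.MathematicalPhysics.QuantumFieldTheory.Balaban1983to89.B1Eq324BenfattoClassRescale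
open Literature.MathematicalPhysics.QuantumFieldTheory.Balaban1983to89.B1Eq324BenfattoClassEntryRows
  (classRow_Jc_le_of_abs_le_exp classRow_M_le_of_abs_le_exp classRow_M₂_le_of_abs_le_exp)

variable {d : ℕ}

/-- ★★★ **[Balaban1982Higgs1] (3.24) FOR THE GAUSSIAN FIELD OF EVERY CLASS MEMBER, ANY `γ_A > 0`, NO PAD** — for `0 < d` and constants `0 < γ_A`,
`0 ≤ J_c < γ_A`, `θ > 0`, `M, M₂ ≥ 0`, every `t D`, `ϰ > 0`, `b₀ > 0`, `p₀ > 2/3`, `σ > 0`, `c ≥ 0`, `0 < κ < σ(t+1)`: there are `η₀ ∈ (0,1]`, `C ≥ 0`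
such that for all `η ≤ η₀`, every member `(Λ, A, K)` (`hK`, `Λ ≠ ∅`, `A` symmetric `γ_A`-coercive, Combes–Thomas row `J_c` at rate `θ`, absolute rows
`M`, `M₂`) and every `(s, I, J, a)` with `I ≠ ∅`, `J ⊆ I`, `J ⊆ Λ`, `coefSup ≤ c·η^σ`:
`0 < ∫Π_Δχ̂_{p(η)}e^{H_J}dμ_K ∧ |log ∫Π_Δχ̂_{p(η)}e^{H_J}dμ_K − cumulantSum μ_K H_J t| ≤ C·η^κ·|I|`.
Proof: seat n08-d's `eq324_kernel_noPad` at the scaled constants `(λ²γ_A ≥ 2, λ²J_c, θ, λ²M, λ²M₂)`, threshold constant `b₀/λ`, coefficient constant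
`(max 1 λ)^D c`, applied to the scaled member `(Λ, λ²A, λ⁻²K)` and the scaled coefficients `a_λ`; then `…ClassRescale` §4 reads the conclusion on
`(Λ, A, K, a, b₀)`. [cite: Balaban1982Higgs1, (3.24) p.616; BenfattoEtAl1978, Lemma (4.5)–(4.7) p.152 «E z_Δ² = ½»;
Balaban1985BackgroundPropagators, Sect. E p.428 (class form; ours)] -/
theorem eq324_kernel_noPad_anyGamma (hd : 0 < d) {γA Jc θ M M₂ : ℝ} (hγA0 : 0 < γA) (hJc0 : 0 ≤ Jc) (hJcγ : Jc < γA) (hθ : 0 < θ)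
    (hM0 : 0 ≤ M) (hM₂0 : 0 ≤ M₂)
    (t D : ℕ) {ϰ : ℝ} (hϰ : 0 < ϰ) {b₀ p₀ σ c κ : ℝ} (hb₀ : 0 < b₀) (hp₀ : 2 / 3 < p₀) (hσ : 0 < σ) (hc : 0 ≤ c) (hκ : 0 < κ)
    (hκσ : κ < σ * (t + 1)) :
    ∃ η₀ C : ℝ, 0 < η₀ ∧ η₀ ≤ 1 ∧ 0 ≤ C ∧ ∀ η : ℝ, 0 < η → η ≤ η₀ →
      ∀ {Λ : Finset (B1Eq324BenfattoLemma.Site d)} {A : Matrix Λ Λ ℝ} {K : B1Eq324BenfattoLemma.Site d → B1Eq324BenfattoLemma.Site d → ℝ},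
        (∀ x y, K x y = if h : x ∈ Λ ∧ y ∈ Λ then (A⁻¹ : Matrix Λ Λ ℝ) ⟨x, h.1⟩ ⟨y, h.2⟩ else 0) → Λ.Nonempty →
        (∀ e e', A e e' = A e' e) → (∀ x : Λ → ℝ, γA * ∑ e, x e ^ 2 ≤ ∑ e, ∑ e', A e e' * x e * x e') →
        (∀ e : Λ, ∑ e' : Λ, |A e e'| * (Real.cosh (θ * Real.sqrt (∑ j, ((((e : B1Eq324BenfattoLemma.Site d) j : ℝ) - ((e' : B1Eq324BenfattoLemma.Site d) j : ℝ))) ^ 2)) - 1) ≤ Jc) →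
        (∀ e : Λ, ∑ e' : Λ, |A e e'| * (1 + Real.sqrt (∑ j, ((((e : B1Eq324BenfattoLemma.Site d) j : ℝ) - ((e' : B1Eq324BenfattoLemma.Site d) j : ℝ))) ^ 2)) ≤ M) →
        (∀ e : Λ, ∑ e' : Λ, |A e e'| * Real.exp (θ / 2 * Real.sqrt (∑ j, ((((e : B1Eq324BenfattoLemma.Site d) j : ℝ) - ((e' : B1Eq324BenfattoLemma.Site d) j : ℝ))) ^ 2)) ≤ M₂) →
        ∀ (s : ℕ) (I J : Finset (B1Eq324BenfattoLemma.Site d)) (a : Coef d), I.Nonempty → J ⊆ I → J ⊆ Λ →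
          coefSup s D a J ≤ c * η ^ σ →
          0 < ∫ z, cutoffBoltzmann (hamiltonian s D ϰ a J) I (B10.pFun b₀ p₀ η) z ∂gaussianFieldOfKernel K ∧
            |Real.log (∫ z, cutoffBoltzmann (hamiltonian s D ϰ a J) I (B10.pFun b₀ p₀ η) z ∂gaussianFieldOfKernel K) -
                cumulantSum (gaussianFieldOfKernel K) (hamiltonian s D ϰ a J) t| ≤ C * η ^ κ * I.card := by
  -- the normalising scale
  obtain ⟨lam, hlam1, hhalf⟩ := exists_normalising_scale hγA0
  have hlam : 0 < lam := lt_of_lt_of_le one_pos hlam1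
  have hr0 : 0 < lam ^ 2 := pow_pos hlam 2
  have hγA2 : 2 ≤ lam ^ 2 * γA := (one_div_le_one_div (mul_pos hr0 hγA0) two_pos).mp hhalf
  have hc' : 0 ≤ (max 1 lam) ^ D * c := mul_nonneg (pow_nonneg (le_trans zero_le_one (le_max_left _ _)) _) hc
  -- seat n08-d's theorem at the scaled constants
  obtain ⟨η₀, C, hη₀, hη₀1, hC, hE⟩ :=
    eq324_kernel_noPad (d := d) hd hγA2 (mul_nonneg hr0.le hJc0) (mul_lt_mul_of_pos_left hJcγ hr0) hθ
      (mul_nonneg hr0.le hM0) (mul_nonneg hr0.le hM₂0) t D hϰ (div_pos hb₀ hlam) hp₀ hσ hc' hκ hκσ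
  refine ⟨η₀, C, hη₀, hη₀1, hC, fun η hη hηle Λ A K hK hΛ hAs hγA hJc hM hM₂ s I J a hI hJI hJΛ hA => ?_⟩
  have hKpsd : IsPosSemidefKernel K := isPosSemidefKernel_of_member hK hAs hγA0 hγA
  -- the scaled coefficient bound
  have hA' : coefSup s D (fun p Δ n => lam ^ (∑ i, n i) * a p Δ n) J ≤ (max 1 lam) ^ D * c * η ^ σ := by
    refine (coefSup_scale_le s D a J lam).trans ?_
    rw [abs_of_pos hlam, mul_assoc]
    exact mul_le_mul_of_nonneg_left hA (pow_nonneg (le_trans zero_le_one (le_max_left _ _)) _)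
  -- the scaled member `(Λ, λ²A, λ⁻²K)` and the scaled data
  have key := hE η hη hηle (Λ := Λ) (A := lam ^ 2 • A) (K := fun x y => (lam ^ 2)⁻¹ * K x y)
    (kernel_smul hK hAs hγA0 hγA hr0.ne') hΛ (symm_smul hAs _) (coercive_smul hγA hr0.le)
    (rowBound_smul hJc hr0.le) (rowBound_smul hM hr0.le) (rowBound_smul hM₂ hr0.le)
    s I J (fun p Δ n => lam ^ (∑ i, n i) * a p Δ n) hI hJI hJΛ hA'
  rw [pFun_div, integral_cutoffBoltzmann_scaled_kernel_eq hKpsd a J I _ hlam, cumulantSum_scaled_kernel_eq hKpsd a J hlam t] at key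
  exact key

/-- ★★★ **d = 3 ∕ B1's instance, any `γ_A > 0` — `t = n̄ = 6`, coefficients `∝ η^{1/2}`, `κ = 13/4 > 3`, NO PAD**.
[cite: Balaban1982Higgs1, (3.24) p.616 «e.g. n > 6»; Balaban1985UV3, p.261 «up to the sixth order» (class form; ours)] -/
theorem eq324_kernel_noPad_anyGamma_seven (hd : 0 < d) {γA Jc θ M M₂ : ℝ} (hγA0 : 0 < γA) (hJc0 : 0 ≤ Jc) (hJcγ : Jc < γA) (hθ : 0 < θ)
    (hM0 : 0 ≤ M) (hM₂0 : 0 ≤ M₂)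
    (D : ℕ) {ϰ : ℝ} (hϰ : 0 < ϰ) {b₀ p₀ c : ℝ} (hb₀ : 0 < b₀) (hp₀ : 2 / 3 < p₀) (hc : 0 ≤ c) :
    ∃ η₀ C : ℝ, 0 < η₀ ∧ η₀ ≤ 1 ∧ 0 ≤ C ∧ ∀ η : ℝ, 0 < η → η ≤ η₀ →
      ∀ {Λ : Finset (B1Eq324BenfattoLemma.Site d)} {A : Matrix Λ Λ ℝ} {K : B1Eq324BenfattoLemma.Site d → B1Eq324BenfattoLemma.Site d → ℝ},
        (∀ x y, K x y = if h : x ∈ Λ ∧ y ∈ Λ then (A⁻¹ : Matrix Λ Λ ℝ) ⟨x, h.1⟩ ⟨y, h.2⟩ else 0) → Λ.Nonempty →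
        (∀ e e', A e e' = A e' e) → (∀ x : Λ → ℝ, γA * ∑ e, x e ^ 2 ≤ ∑ e, ∑ e', A e e' * x e * x e') →
        (∀ e : Λ, ∑ e' : Λ, |A e e'| * (Real.cosh (θ * Real.sqrt (∑ j, ((((e : B1Eq324BenfattoLemma.Site d) j : ℝ) - ((e' : B1Eq324BenfattoLemma.Site d) j : ℝ))) ^ 2)) - 1) ≤ Jc) →
        (∀ e : Λ, ∑ e' : Λ, |A e e'| * (1 + Real.sqrt (∑ j, ((((e : B1Eq324BenfattoLemma.Site d) j : ℝ) - ((e' : B1Eq324BenfattoLemma.Site d) j : ℝ))) ^ 2)) ≤ M) →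
        (∀ e : Λ, ∑ e' : Λ, |A e e'| * Real.exp (θ / 2 * Real.sqrt (∑ j, ((((e : B1Eq324BenfattoLemma.Site d) j : ℝ) - ((e' : B1Eq324BenfattoLemma.Site d) j : ℝ))) ^ 2)) ≤ M₂) →
        ∀ (s : ℕ) (I J : Finset (B1Eq324BenfattoLemma.Site d)) (a : Coef d), I.Nonempty → J ⊆ I → J ⊆ Λ →
          coefSup s D a J ≤ c * η ^ (1 / 2 : ℝ) →
          0 < ∫ z, cutoffBoltzmann (hamiltonian s D ϰ a J) I (B10.pFun b₀ p₀ η) z ∂gaussianFieldOfKernel K ∧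
            |Real.log (∫ z, cutoffBoltzmann (hamiltonian s D ϰ a J) I (B10.pFun b₀ p₀ η) z ∂gaussianFieldOfKernel K) -
                cumulantSum (gaussianFieldOfKernel K) (hamiltonian s D ϰ a J) 6| ≤ C * η ^ (13 / 4 : ℝ) * I.card :=
  eq324_kernel_noPad_anyGamma hd hγA0 hJc0 hJcγ hθ hM0 hM₂0 6 D hϰ hb₀ hp₀ (by norm_num) hc (by norm_num) (by norm_num)

/-! ## §2  The class road's output in [Balaban1985BackgroundPropagators] Sect. E's currency: a uniformly coercive, exponentially decaying precision -/

/-- kernel: the rate choice — for `γ_A > 0`, `K_A ≥ 0`, `κ_A > 0` and `K_d ≥ 0` the rate `θ := min (κ_A/4) (min 1 (γ_A κ_A²/(64 (K_A K_d + 1))))` is positive,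
`≤ κ_A/4`, and makes the decay Combes–Thomas row `K_A·(32θ²/κ_A²)·K_d` at most `γ_A/2`. [folklore] -/
private theorem rate_choice {γA KA κA Kd : ℝ} (hγA0 : 0 < γA) (hKA : 0 ≤ KA) (hκA : 0 < κA) (hKd : 0 ≤ Kd) :
    0 < min (κA / 4) (min 1 (γA * κA ^ 2 / (64 * (KA * Kd + 1)))) ∧
      min (κA / 4) (min 1 (γA * κA ^ 2 / (64 * (KA * Kd + 1)))) ≤ κA / 4 ∧
      KA * (32 * (min (κA / 4) (min 1 (γA * κA ^ 2 / (64 * (KA * Kd + 1))))) ^ 2 / κA ^ 2) * Kd ≤ γA / 2 := by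
  set θ := min (κA / 4) (min 1 (γA * κA ^ 2 / (64 * (KA * Kd + 1)))) with hθdef
  have hP : 0 < KA * Kd + 1 := by positivity
  have hq0 : 0 < γA * κA ^ 2 / (64 * (KA * Kd + 1)) := by positivity
  have hθ0 : 0 < θ := lt_min (by positivity) (lt_min one_pos hq0)
  have hθ1 : θ ≤ 1 := (min_le_right _ _).trans (min_le_left _ _)
  have hθq : θ ≤ γA * κA ^ 2 / (64 * (KA * Kd + 1)) := (min_le_right _ _).trans (min_le_right _ _)
  refine ⟨hθ0, min_le_left _ _, ?_⟩
  have hsq : θ ^ 2 ≤ γA * κA ^ 2 / (64 * (KA * Kd + 1)) := by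
    rw [sq]
    calc θ * θ ≤ 1 * (γA * κA ^ 2 / (64 * (KA * Kd + 1))) := mul_le_mul hθ1 hθq hθ0.le zero_le_one
      _ = _ := one_mul _
  have hκ2 : 0 < κA ^ 2 := by positivity
  calc KA * (32 * θ ^ 2 / κA ^ 2) * Kd ≤ KA * (32 * (γA * κA ^ 2 / (64 * (KA * Kd + 1))) / κA ^ 2) * Kd := by
        refine mul_le_mul_of_nonneg_right (mul_le_mul_of_nonneg_left ?_ hKA) hKd
        exact div_le_div_of_nonneg_right (mul_le_mul_of_nonneg_left hsq (by norm_num)) hκ2.le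
    _ = γA / 2 * (KA * Kd / (KA * Kd + 1)) := by
        field_simp
        ring
    _ ≤ γA / 2 * 1 := mul_le_mul_of_nonneg_left ((div_le_one hP).mpr (by linarith)) (by positivity)
    _ = γA / 2 := mul_one _

/-- ★★★ **(3.24) FOR THE GAUSSIAN FIELD OF EVERY SYMMETRIC, UNIFORMLY COERCIVE, EXPONENTIALLY DECAYING PRECISION** — the class road's output in the
currency of [Balaban1985BackgroundPropagators] Sect. E p. 428 («a positive definite operator … with a lower bound γ₀ > 0 independent of k and U … a
uniform exponential decay»): for `0 < d`, constants `γ_A > 0`, `K_A ≥ 0`, `κ_A > 0`, every `t D`, `ϰ > 0`, `b₀ > 0`, `p₀ > 2/3`, `σ > 0`, `c ≥ 0`,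
`0 < κ < σ(t+1)`: there are `η₀ ∈ (0,1]`, `C ≥ 0` such that for all `η ≤ η₀`, every `(Λ, A, K)` with `K` the zero-extended `A⁻¹`, `Λ ≠ ∅`, `A` symmetric,
`γ_A`-coercive and `|A e e′| ≤ K_A e^{−κ_A|e−e′|₂}`, and every `(s, I, J, a)` with `I ≠ ∅`, `J ⊆ I`, `J ⊆ Λ`, `coefSup ≤ c·η^σ`:
`0 < ∫Π_Δχ̂_{p(η)}e^{H_J}dμ_K ∧ |log ∫Π_Δχ̂_{p(η)}e^{H_J}dμ_K − cumulantSum μ_K H_J t| ≤ C·η^κ·|I|`.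
Proof: the rate `θ` of `rate_choice` (from `(γ_A, K_A, κ_A, d)` alone) and seat n08-d's decay rows `…ClassEntryRows.classRow_{Jc,M,M₂}_le_of_abs_le_exp`
feed `eq324_kernel_noPad_anyGamma` at `J_c = K_A(32θ²/κ_A²)K_d(κ_A/2) ≤ γ_A/2`, `M = K_A(1+2/κ_A)K_d(κ_A/2)`, `M₂ = K_A K_d(κ_A/2)`.
[cite: Balaban1982Higgs1, (3.24) p.616; BenfattoEtAl1978, Lemma (4.5)–(4.7) p.152, Appendix C (C.1)–(C.2) p.164;
Balaban1985BackgroundPropagators, (1.16)–(1.18) p.180, Sect. E p.428 (class form; ours)] -/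
theorem eq324_kernel_of_expDecay (hd : 0 < d) {γA KA κA : ℝ} (hγA0 : 0 < γA) (hKA : 0 ≤ KA) (hκA : 0 < κA)
    (t D : ℕ) {ϰ : ℝ} (hϰ : 0 < ϰ) {b₀ p₀ σ c κ : ℝ} (hb₀ : 0 < b₀) (hp₀ : 2 / 3 < p₀) (hσ : 0 < σ) (hc : 0 ≤ c) (hκ : 0 < κ)
    (hκσ : κ < σ * (t + 1)) :
    ∃ η₀ C : ℝ, 0 < η₀ ∧ η₀ ≤ 1 ∧ 0 ≤ C ∧ ∀ η : ℝ, 0 < η → η ≤ η₀ →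
      ∀ {Λ : Finset (B1Eq324BenfattoLemma.Site d)} {A : Matrix Λ Λ ℝ} {K : B1Eq324BenfattoLemma.Site d → B1Eq324BenfattoLemma.Site d → ℝ},
        (∀ x y, K x y = if h : x ∈ Λ ∧ y ∈ Λ then (A⁻¹ : Matrix Λ Λ ℝ) ⟨x, h.1⟩ ⟨y, h.2⟩ else 0) → Λ.Nonempty →
        (∀ e e', A e e' = A e' e) → (∀ x : Λ → ℝ, γA * ∑ e, x e ^ 2 ≤ ∑ e, ∑ e', A e e' * x e * x e') →
        (∀ e e' : Λ, |A e e'| ≤ KA * Real.exp (-(κA * Real.sqrt (∑ j, ((((e : B1Eq324BenfattoLemma.Site d) j : ℝ) - ((e' : B1Eq324BenfattoLemma.Site d) j : ℝ))) ^ 2)))) →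
        ∀ (s : ℕ) (I J : Finset (B1Eq324BenfattoLemma.Site d)) (a : Coef d), I.Nonempty → J ⊆ I → J ⊆ Λ →
          coefSup s D a J ≤ c * η ^ σ →
          0 < ∫ z, cutoffBoltzmann (hamiltonian s D ϰ a J) I (B10.pFun b₀ p₀ η) z ∂gaussianFieldOfKernel K ∧
            |Real.log (∫ z, cutoffBoltzmann (hamiltonian s D ϰ a J) I (B10.pFun b₀ p₀ η) z ∂gaussianFieldOfKernel K) -
                cumulantSum (gaussianFieldOfKernel K) (hamiltonian s D ϰ a J) t| ≤ C * η ^ κ * I.card := by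
  -- the lattice constant `K_d(κ_A/2)` and the rate
  have hKd : 0 ≤ (2 / (1 - Real.exp (-(κA / 2 / Real.sqrt d))) * Real.exp (κA / 2 / Real.sqrt d)) ^ d := by
    refine pow_nonneg (mul_nonneg (div_nonneg zero_le_two ?_) (Real.exp_pos _).le) _
    rw [sub_nonneg, Real.exp_le_one_iff, neg_nonpos]
    positivity
  obtain ⟨hθ0, hθκ4, hJcle⟩ := rate_choice hγA0 hKA hκA hKd
  set θ := min (κA / 4) (min 1 (γA * κA ^ 2 / (64 * (KA * ((2 / (1 - Real.exp (-(κA / 2 / Real.sqrt d))) * Real.exp (κA / 2 / Real.sqrt d)) ^ d) + 1))))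
    with hθdef
  have hθκ : θ ≤ κA := hθκ4.trans (by linarith)
  have hJc0 : 0 ≤ KA * (32 * θ ^ 2 / κA ^ 2) * ((2 / (1 - Real.exp (-(κA / 2 / Real.sqrt d))) * Real.exp (κA / 2 / Real.sqrt d)) ^ d) := by
    positivity
  have hJcγ : KA * (32 * θ ^ 2 / κA ^ 2) * ((2 / (1 - Real.exp (-(κA / 2 / Real.sqrt d))) * Real.exp (κA / 2 / Real.sqrt d)) ^ d) < γA :=
    hJcle.trans_lt (by linarith)
  have hM0 : 0 ≤ KA * ((1 + 2 / κA) * (2 / (1 - Real.exp (-(κA / 2 / Real.sqrt d))) * Real.exp (κA / 2 / Real.sqrt d)) ^ d) := by positivity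
  have hM₂0 : 0 ≤ KA * (2 / (1 - Real.exp (-(κA / 2 / Real.sqrt d))) * Real.exp (κA / 2 / Real.sqrt d)) ^ d := mul_nonneg hKA hKd
  obtain ⟨η₀, C, hη₀, hη₀1, hC, hE⟩ :=
    eq324_kernel_noPad_anyGamma (d := d) hd hγA0 hJc0 hJcγ hθ0 hM0 hM₂0 t D hϰ hb₀ hp₀ hσ hc hκ hκσ
  refine ⟨η₀, C, hη₀, hη₀1, hC, fun η hη hηle Λ A K hK hΛ hAs hγA hdec s I J a hI hJI hJΛ hA => ?_⟩
  exact hE η hη hηle hK hΛ hAs hγA (classRow_Jc_le_of_abs_le_exp hKA hκA hθ0.le hθκ4 hdec) (classRow_M_le_of_abs_le_exp hKA hκA hdec)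
    (classRow_M₂_le_of_abs_le_exp hKA hκA hθκ hdec) s I J a hI hJI hJΛ hA

/-- ★★★ **d = 3 ∕ B1's instance in Sect. E's currency — `t = n̄ = 6`, coefficients `∝ η^{1/2}`, `κ = 13/4 > 3`**.
[cite: Balaban1982Higgs1, (3.24) p.616 «e.g. n > 6»; Balaban1985UV3, p.261 «up to the sixth order», p.261 «a covariance having an exponential decay property»;
Balaban1985BackgroundPropagators, Sect. E p.428 (class form; ours)] -/
theorem eq324_kernel_of_expDecay_seven (hd : 0 < d) {γA KA κA : ℝ} (hγA0 : 0 < γA) (hKA : 0 ≤ KA) (hκA : 0 < κA)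
    (D : ℕ) {ϰ : ℝ} (hϰ : 0 < ϰ) {b₀ p₀ c : ℝ} (hb₀ : 0 < b₀) (hp₀ : 2 / 3 < p₀) (hc : 0 ≤ c) :
    ∃ η₀ C : ℝ, 0 < η₀ ∧ η₀ ≤ 1 ∧ 0 ≤ C ∧ ∀ η : ℝ, 0 < η → η ≤ η₀ →
      ∀ {Λ : Finset (B1Eq324BenfattoLemma.Site d)} {A : Matrix Λ Λ ℝ} {K : B1Eq324BenfattoLemma.Site d → B1Eq324BenfattoLemma.Site d → ℝ},
        (∀ x y, K x y = if h : x ∈ Λ ∧ y ∈ Λ then (A⁻¹ : Matrix Λ Λ ℝ) ⟨x, h.1⟩ ⟨y, h.2⟩ else 0) → Λ.Nonempty →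
        (∀ e e', A e e' = A e' e) → (∀ x : Λ → ℝ, γA * ∑ e, x e ^ 2 ≤ ∑ e, ∑ e', A e e' * x e * x e') →
        (∀ e e' : Λ, |A e e'| ≤ KA * Real.exp (-(κA * Real.sqrt (∑ j, ((((e : B1Eq324BenfattoLemma.Site d) j : ℝ) - ((e' : B1Eq324BenfattoLemma.Site d) j : ℝ))) ^ 2)))) →
        ∀ (s : ℕ) (I J : Finset (B1Eq324BenfattoLemma.Site d)) (a : Coef d), I.Nonempty → J ⊆ I → J ⊆ Λ →
          coefSup s D a J ≤ c * η ^ (1 / 2 : ℝ) →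
          0 < ∫ z, cutoffBoltzmann (hamiltonian s D ϰ a J) I (B10.pFun b₀ p₀ η) z ∂gaussianFieldOfKernel K ∧
            |Real.log (∫ z, cutoffBoltzmann (hamiltonian s D ϰ a J) I (B10.pFun b₀ p₀ η) z ∂gaussianFieldOfKernel K) -
                cumulantSum (gaussianFieldOfKernel K) (hamiltonian s D ϰ a J) 6| ≤ C * η ^ (13 / 4 : ℝ) * I.card :=
  eq324_kernel_of_expDecay hd hγA0 hKA hκA 6 D hϰ hb₀ hp₀ (by norm_num) hc (by norm_num) (by norm_num)

end Literature.MathematicalPhysics.QuantumFieldTheory.Balaban1983to89.B1Eq324BenfattoKernelEq324AnyGamma
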